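import Summits.ResolutionOfSingularities.ResolutionOfSingularities.Theorems.PAlterationAssemblyPerfect
import Mathlib.FieldTheory.IsPerfectClosure
import Mathlib.AlgebraicGeometry.Morphisms.Integral
import HarnessLib

/-!
# `PAlteration.Assembly` (stmt-ResolutionOfSingularities-0553): base change to the perfect closure

Route `ResolutionOfSingularities/pAlteration`, item `Assembly` (stmt-0553); helper file
(`--supports`). First step of **Theorem B** (every field from perfect fields): for a field `k`
of characteristic `p` with perfect closure `K = k^{p^{-∞}}` and an integral separated `k`-scheme
`X` of finite type, the reduced base change `X^∞ = (Spec K ×_k X)_red` is an integral separated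
`K`-scheme of finite type (`Spec K → Spec k` is a universal homeomorphism: radicial, integral,
surjective), so Theorem A gives it a resolution `R → X^∞` from the thesis at `p`
(`exists_resolution_perfectClosure`).

Also recorded: `Spec` of a radicial (purely inseparable) extension of fields is universally
injective (`universallyInjective_specMap_field_of_pow_mem`), surjective and integral.
-/

-- single-problem summit: the doubled namespace component `ResolutionOfSingularities` is forced
set_option linter.dupNamespace false

noncomputable section

open CategoryTheory CategoryTheory.Limits AlgebraicGeometry TopologicalSpace Topology

open Literature.AlgebraicGeometry.Resolution Scheme.IdealSheafData

namespace Summit.ResolutionOfSingularities.ResolutionOfSingularities.Theorems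

universe u

/-! ## `Spec` of a radicial field extension -/

section Radicial

variable {k K : Type u} [Field k] [Field K] (i : k →+* K) (p : ℕ) [Fact p.Prime] [CharP K p]

/-- `Spec K → Spec k` is universally injective when every element of `K` has a `p^n`-th power in
`k` (Stacks 01S4 via injectivity on field-valued points: two embeddings of `K` agreeing on `k`
agree, Frobenius being injective). [folklore] -/
theorem universallyInjective_specMap_field_of_pow_mem (hrad : ∀ x : K, ∃ (n : ℕ) (y : k), i y = x ^ p ^ n) :
    UniversallyInjective (Spec.map (CommRingCat.ofHom i)) := by
  refine ((tfae_universallyInjective (Spec.map (CommRingCat.ofHom i))).out 0 1).mpr ?_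
  intro L _ g₁ g₂ hg
  obtain ⟨α, rfl⟩ : ∃ α, Spec.map α = g₁ := ⟨Spec.preimage g₁, Spec.map_preimage g₁⟩
  obtain ⟨β, rfl⟩ : ∃ β, Spec.map β = g₂ := ⟨Spec.preimage g₂, Spec.map_preimage g₂⟩
  have hαβ : CommRingCat.ofHom i ≫ α = CommRingCat.ofHom i ≫ β := by
    apply Spec.map_injective
    simpa only [Spec.map_comp] using hg
  have hpL : (p : L) = 0 := by rw [← map_natCast α.hom p, CharP.cast_eq_zero, map_zero]
  haveI : CharP L p := (CharP.charP_iff_prime_eq_zero Fact.out).mpr hpL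
  congr 1
  ext x
  obtain ⟨n, y, hy⟩ := hrad x
  have h : α.hom x ^ p ^ n = β.hom x ^ p ^ n := by
    rw [← map_pow, ← map_pow, ← hy]
    exact congrArg (fun φ : CommRingCat.of k ⟶ CommRingCat.of L => φ.hom y) hαβ
  exact (frobenius_inj L p).iterate n
    (by simpa only [← coe_iterateFrobenius, iterateFrobenius_def] using h)

omit [Fact p.Prime] [CharP K p] in
/-- `Spec K → Spec k` is surjective for fields. [folklore] -/
theorem surjective_specMap_field : Surjective (Spec.map (CommRingCat.ofHom i)) :=
  ⟨fun _ => ⟨default, Subsingleton.elim _ _⟩⟩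

omit [CharP K p] in
/-- `Spec K → Spec k` is integral when every element of `K` has a `p^n`-th power in `k`.
[folklore] -/
theorem isIntegralHom_specMap_of_pow_mem (hrad : ∀ x : K, ∃ (n : ℕ) (y : k), i y = x ^ p ^ n) :
    IsIntegralHom (Spec.map (CommRingCat.ofHom i)) := by
  rw [IsIntegralHom.SpecMap_iff]
  intro x
  obtain ⟨n, y, hy⟩ := hrad x
  exact ⟨Polynomial.X ^ p ^ n - Polynomial.C y, Polynomial.monic_X_pow_sub_C y
    (pow_ne_zero n (Fact.out : p.Prime).ne_zero), by simp [Polynomial.eval₂_sub, hy]⟩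

end Radicial

/-! ## Pull-backs along universal homeomorphisms are irreducible -/

section Homeo

variable {X Y T : Scheme.{u}} (h : X ⟶ T) (ρ : Y ⟶ T)

/-- A universally closed, universally injective, surjective morphism (a universal homeomorphism)
is a homeomorphism. [folklore] -/
theorem isHomeomorph_of_universallyClosed_of_universallyInjective [UniversallyClosed h]
    [UniversallyInjective h] [Surjective h] : IsHomeomorph h.base :=
  isHomeomorph_iff_continuous_isClosedMap_bijective.mpr
    ⟨h.continuous, h.isClosedMap, h.injective, h.surjective⟩

/-- The pull-back of an irreducible scheme along a universal homeomorphism is irreducible.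
[folklore] -/
theorem irreducibleSpace_pullback_of_universallyClosed [UniversallyClosed h]
    [UniversallyInjective h] [Surjective h] [IrreducibleSpace Y] :
    IrreducibleSpace ↑(pullback h ρ) :=
  haveI : UniversallyInjective (pullback.snd h ρ) := universallyInjective_pullback_snd h ρ
  (isHomeomorph_of_universallyClosed_of_universallyInjective
    (pullback.snd h ρ)).homeomorph.irreducibleSpace_iff.mpr ‹_›

end Homeo

/-! ## The reduced base change to the perfect closure and its resolution -/

section PerfectClosureBase

variable (p : ℕ) [Fact p.Prime]

/-- Every element of the perfect closure has a `p^n`-th power in `k`. [folklore] -/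
theorem perfectClosure_pow_mem {k : Type u} [Field k] [CharP k p] (x : PerfectClosure k p) :
    ∃ (n : ℕ) (y : k), PerfectClosure.of k p y = x ^ p ^ n :=
  IsPRadical.pow_mem (PerfectClosure.of k p) p x

/-- The base change `Spec K ×_k X` of an integral `X` to the perfect closure `K` is irreducible.
[folklore] -/
theorem irreducibleSpace_pullback_perfectClosure {k : Type u} [Field k] [CharP k p]
    {X : Scheme.{u}} (f : X ⟶ Spec (.of k)) [IsIntegral X] :
    IrreducibleSpace ↑(pullback (Spec.map (CommRingCat.ofHom (PerfectClosure.of k p))) f) := by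
  haveI := universallyInjective_specMap_field_of_pow_mem (PerfectClosure.of k p) p
    (perfectClosure_pow_mem p)
  haveI := surjective_specMap_field (PerfectClosure.of k p)
  haveI := isIntegralHom_specMap_of_pow_mem (PerfectClosure.of k p) p (perfectClosure_pow_mem p)
  exact irreducibleSpace_pullback_of_universallyClosed _ f

variable {k : Type} [Field k] [CharP k p] {X : Scheme.{0}} (f : X ⟶ Spec (.of k))

/-- **The resolution over the perfect closure.** Under Theorem A's hypotheses at the prime `p`
(the two conjuncts of the thesis), for an integral separated `k`-scheme `X` of finite type,
`char k = p`, the reduced base change `X^∞ = (Spec K ×_k X)_red` to the perfect closure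
`K = k^{p^{-∞}}` is integral and admits a proper birational `π : R → X^∞` with `R` regular and
integral. [folklore] -/
theorem exists_resolution_perfectClosure (hp : p.Prime)
    (hPI : ∀ (k : Type) [Field k] [CharP k p] (X : Scheme.{0}) (f : X ⟶ Spec (.of k)),
      IsSeparated f → LocallyOfFiniteType f → QuasiCompact f → IsIntegral X →
      ∃ (X' : Scheme.{0}) (g : X' ⟶ X), IsProper g ∧ IsIntegral X' ∧ Scheme.IsRegular X' ∧
        Function.Surjective g.base ∧ ∃ U : X.Opens, Dense (U : Set X) ∧ IsFinite (g ∣_ U) ∧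
        UniversallyInjective (g ∣_ U))
    (hPC : ∀ (k : Type) [Field k] [CharP k p] (Y X : Scheme.{0}) (f : Y ⟶ Spec (.of k))
      (g : X ⟶ Y), IsSeparated f → LocallyOfFiniteType f → QuasiCompact f → IsIntegral Y →
      Scheme.IsRegular Y → IsIntegral X → IsFinite g → UniversallyInjective g →
      Function.Surjective g.base → Scheme.HasResolution X)
    [IsSeparated f] [LocallyOfFiniteType f] [QuasiCompact f] [IsIntegral X] :
    IsIntegral (vanishingIdeal (⊤ : Closeds
        ↑(pullback (Spec.map (CommRingCat.ofHom (PerfectClosure.of k p))) f))).subscheme ∧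
    ∃ (R : Scheme.{0}) (π : R ⟶ (vanishingIdeal (⊤ : Closeds
        ↑(pullback (Spec.map (CommRingCat.ofHom (PerfectClosure.of k p))) f))).subscheme),
      IsProper π ∧ IsBirational π ∧ Scheme.IsRegular R ∧ IsIntegral R := by
  haveI := irreducibleSpace_pullback_perfectClosure p f
  set XK := pullback (Spec.map (CommRingCat.ofHom (PerfectClosure.of k p))) f with hXK
  haveI hint : IsIntegral (vanishingIdeal (⊤ : Closeds ↑XK)).subscheme :=
    isIntegral_subscheme_vanishingIdeal_top
  refine ⟨hint, ?_⟩
  set ι₀ := (vanishingIdeal (⊤ : Closeds ↑XK)).subschemeι with hι₀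
  let fK : (vanishingIdeal (⊤ : Closeds ↑XK)).subscheme ⟶ Spec (.of (PerfectClosure k p)) :=
    ι₀ ≫ pullback.fst _ f
  haveI : IsSeparated fK := inferInstance
  haveI : LocallyOfFiniteType fK := inferInstance
  haveI : QuasiCompact fK := inferInstance
  obtain ⟨R, π, hπ⟩ := hasResolution_of_pialt_picover_perfectField p hp hPI hPC
    (PerfectClosure k p) _ fK
  haveI := hπ.isProper
  haveI : IrreducibleSpace R := hπ.isBirational.irreducibleSpace
  haveI : IsReduced R := hπ.isRegular.isReduced
  exact ⟨R, π, hπ.isProper, hπ.isBirational, hπ.isRegular,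
    isIntegral_of_irreducibleSpace_of_isReduced R⟩

end PerfectClosureBase

end Summit.ResolutionOfSingularities.ResolutionOfSingularities.Theorems

end
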